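import Mathlib
import HarnessLib
import Summits.HubbardSuperconductivity.HubbardSuperconductivity.Theorems.KLProgrammeKLRegimeEnginePairLadderSigned

/-!
# Route `KLProgramme` — crux K3, ENGINE child (gen 4 stmt-HubbardSuperconductivity-19855 / its gen-5 successor), clause (E2) at `1 ≤ n`:
# the signed-weights constructor WITH A TRANSPORTED WEIGHT PROPERTY — for the (E2-v9) text (E2-DRIVE repair: extra budget (X) + weight
# conjunct (ANG), plan g12 (R12′) 2026-08-27T02:0xZ, p1 g8 draft `PairLadderStepAtV9`)

Cell gate-hubbard-kl, seat hubbard-kl-k3c1-p1 (g4).  `klpls_signedStepReal_of_expansion` (p469901) builds the REAL aggregated weights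
`w p = Re Σ_b z′(p,b)` of the (E2) clause from the engine's frequency-resolved `z′` and returns them existentially with the (m)/(neg) facts, the
two-sided inverse and an ABSTRACT budget `B Qm k k′`.  The repaired (E2-v9) text adds ONE conjunct about the SAME `w` — the angular-mass profile
(ANG) `∀ b η, (4^n)⁻¹ ≤ η → Σ_{p : |p − b|_𝕋 ≤ η} |w p| ≤ G.bhi·η` — and enlarges the budget by the crossed-channel gains (X); since
`|w p| = ‖Σ_b z′(p,b)‖` POINTWISE, ANY property of the function `p ↦ |w p|` is a property of `p ↦ ‖Σ_b z′(p,b)‖`, which the engine states on its own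
data.  This file is that transport, once, for an ARBITRARY per-class predicate `Φ Qm : (TorusSite 2 L → ℝ) → Prop` (so (ANG) with any constant /
radius convention, or any later profile clause, is served by the same theorem): `klpls_abs_aggregated_eq`,
**`klpls_signedStepReal_of_expansion_prop`** (= p469901's theorem + `Φ Qm (fun p => ‖Σ_b z′(p,b)‖)` in, `Φ Qm (fun p => |w p|)` out; abstract `E`,
`B`).  The (E2-v9) instance (`E := 2·klEdge`, `B := V8 budget + (P.Klam U)²(phGain n |k−k′|_𝕋 + phGain n |k+k′−Qm|_𝕋)`, `Φ :=` (ANG)) is a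
20-line corollary filed the minute the gen-5 bundle carrying `PairLadderStepAtV9` is in the tree.  Bookkeeping only; nothing about the model.  0 kit.
-/

noncomputable section

namespace Summit.HubbardSuperconductivity.HubbardSuperconductivity.Theorems.KLRegimeSplit

set_option linter.dupNamespace false -- summit = problem name (single-conjunct summit), D-0017

open Finset Matrix Literature.MathematicalPhysics.QuantumLattice Literature.Probability.LatticeModels
open Summit.HubbardSuperconductivity.HubbardSuperconductivity.Theorems.KLProgrammeCooperResummation
open Summit.HubbardSuperconductivity.HubbardSuperconductivity.Theorems.KLProgrammeLegKernels

section Transport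

variable {S F : Type*} [Fintype F]

/-- If the real weights are the real casts of the aggregated complex weights, their absolute values ARE the norms of the aggregated weights:
`(fun p => (w p : ℂ)) = (fun p => Σ_b z′(p,b))` ⇒ `(fun p => |w p|) = (fun p => ‖Σ_b z′(p,b)‖)`. -/
theorem klpls_abs_aggregated_eq (w : S → ℝ) (z' : S × F → ℂ) (hcast : (fun s => (w s : ℂ)) = fun s => ∑ b, z' (s, b)) :
    (fun p => |w p|) = fun p => ‖∑ b, z' (p, b)‖ := by
  funext p
  have h : (w p : ℂ) = ∑ b, z' (p, b) := congrFun hcast p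
  rw [← h, Complex.norm_real, Real.norm_eq_abs]

end Transport

section Model

variable (L M : ℕ) [NeZero L] [NeZero M]
variable {F : Type*} [Fintype F] [DecidableEq F] [Nonempty F]

/-- **The signed (E2) step at `1 ≤ n`, REAL weights, abstract `E`/`B`, WITH A TRANSPORTED WEIGHT PROPERTY `Φ`.**  As
`klpls_signedStepReal_of_expansion` (p469901), plus: per pair class the engine states `Φ Qm (fun p => ‖Σ_b z′(p,b)‖)` about its own weights, and
the output carries `Φ Qm (fun p => |w p|)` for the constructed real weights `w` (they coincide pointwise).  Use: `Φ Qm f := ∀ b η, (4^n)⁻¹ ≤ η →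
Σ_{p : |p−b|_𝕋 ≤ η} f p ≤ G.bhi·η` = the (ANG) conjunct of (E2-v9); `B Qm k k′ :=` the V8 budget `+ (P.Klam U)²(phGain n |k−k′|_𝕋 + phGain n |k+k′−Qm|_𝕋)`. -/
theorem klpls_signedStepReal_of_expansion_prop {G : GeoConsts} {β U μ : ℝ} {K₀ : TrigPolyC4v} {n : ℕ} (a₀ : F) {m : ℝ}
    (E : TorusSite 2 L → ℝ) (B : TorusSite 2 L → TorusSite 2 L → TorusSite 2 L → ℝ)
    (Φ : TorusSite 2 L → (TorusSite 2 L → ℝ) → Prop)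
    (hm : 0 ≤ m) (hC : ∀ Qm s t, ‖klPairArray L M β U μ K₀ (n - 1) Qm s t‖ ≤ m) (hsmall : G.bhi * m ≤ 1 / 3)
    (hexp : ∀ Qm : TorusSite 2 L, IsPairClassAt L Qm n →
      ∃ (K : Matrix (TorusSite 2 L × F) (TorusSite 2 L × F) ℂ) (z' : TorusSite 2 L × F → ℂ)
        (TK : Matrix (TorusSite 2 L × F) (TorusSite 2 L × F) ℂ) (m' : ℝ),
        0 ≤ m' ∧ (∀ x y, ‖K x y‖ ≤ m') ∧ m' * ∑ x, ‖z' x‖ ≤ 1 / 3 ∧ ∑ x, ‖z' x‖ ≤ G.bhi ∧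
        (∑ p, ‖∑ b, z' (p, b)‖) - (∑ p, ∑ b, z' (p, b)).re ≤ E Qm ∧ (∀ p, (∑ b, z' (p, b)).im = 0) ∧
        Φ Qm (fun p => ‖∑ b, z' (p, b)‖) ∧
        HasSum (fun j : ℕ => K * (-(Matrix.diagonal z' * K)) ^ j) TK ∧
        ∀ k ∈ klBall L μ K₀, ∀ k' ∈ klBall L μ K₀,
          ‖klPairAmplitude L M β U μ K₀ n Qm k k' - TK (k, a₀) (k', a₀)‖ +
            (‖K (k, a₀) (k', a₀) - klPairArray L M β U μ K₀ (n - 1) Qm k k'‖ +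
              3 / 2 * m * ∑ b, ‖K (k, a₀) b - klPairArray L M β U μ K₀ (n - 1) Qm k b.1‖ * ‖z' b‖ +
              3 / 2 * m' * ∑ a, ‖z' a‖ * ‖K a (k', a₀) - klPairArray L M β U μ K₀ (n - 1) Qm a.1 k'‖ +
              9 / 4 * m' * m * ∑ a, ∑ b, ‖z' a‖ * ‖K a b - klPairArray L M β U μ K₀ (n - 1) Qm a.1 b.1‖ * ‖z' b‖) ≤
          B Qm k k') :
    ∀ Qm : TorusSite 2 L, IsPairClassAt L Qm n →
      ∃ w : TorusSite 2 L → ℝ, (∑ p, |w p| ≤ G.bhi) ∧ (∑ p, (|w p| - w p) ≤ E Qm) ∧ (-E Qm ≤ ∑ p, w p) ∧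
        Φ Qm (fun p => |w p|) ∧
        ∃ N : Matrix (TorusSite 2 L) (TorusSite 2 L) ℂ,
          (1 + Matrix.diagonal (fun p => (w p : ℂ)) * klPairArray L M β U μ K₀ (n - 1) Qm) * N = 1 ∧
          N * (1 + Matrix.diagonal (fun p => (w p : ℂ)) * klPairArray L M β U μ K₀ (n - 1) Qm) = 1 ∧
          ∀ k ∈ klBall L μ K₀, ∀ k' ∈ klBall L μ K₀,
            ‖klPairAmplitude L M β U μ K₀ n Qm k k' - (klPairArray L M β U μ K₀ (n - 1) Qm * N) k k'‖ ≤ B Qm k k' := by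
  intro Qm hQm
  obtain ⟨K, z', TK, m', hm', hK, hzK, hzsum, hmass, hreal, hΦ, hTK, hacc⟩ := hexp Qm hQm
  have hzC : m * ∑ x, ‖z' x‖ ≤ 1 / 3 :=
    calc m * ∑ x, ‖z' x‖ ≤ m * G.bhi := mul_le_mul_of_nonneg_left hzsum hm
      _ = G.bhi * m := mul_comm _ _
      _ ≤ 1 / 3 := hsmall
  obtain ⟨w, hcast, hb, hE, hnet, N, hN1, hN2, -, hbd⟩ :=
    klpls_signedStepReal (klPairArray L M β U μ K₀ (n - 1) Qm) K z' hm hm' (hC Qm) hK hzC hzK hzsum hmass hreal TK hTK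
  have hΦw : Φ Qm (fun p => |w p|) := by
    rw [klpls_abs_aggregated_eq w z' hcast]; exact hΦ
  refine ⟨w, hb, hE, hnet, hΦw, N, hN1, hN2, fun k hk k' hk' => ?_⟩
  have h1 := hacc k hk k' hk'
  have h2 := hbd (k, a₀) (k', a₀)
  calc ‖klPairAmplitude L M β U μ K₀ n Qm k k' - (klPairArray L M β U μ K₀ (n - 1) Qm * N) k k'‖
      = ‖(klPairAmplitude L M β U μ K₀ n Qm k k' - TK (k, a₀) (k', a₀)) +
          (TK (k, a₀) (k', a₀) - (klPairArray L M β U μ K₀ (n - 1) Qm * N) k k')‖ := by rw [sub_add_sub_cancel]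
    _ ≤ ‖klPairAmplitude L M β U μ K₀ n Qm k k' - TK (k, a₀) (k', a₀)‖ +
          ‖TK (k, a₀) (k', a₀) - (klPairArray L M β U μ K₀ (n - 1) Qm * N) k k'‖ := norm_add_le _ _
    _ ≤ B Qm k k' := by linarith

end Model

end Summit.HubbardSuperconductivity.HubbardSuperconductivity.Theorems.KLRegimeSplit

end
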